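import Summits.CriticalPhenomena.PercolationContinuityZ3.Theorems.PercNearOneGluingNoHeavyLowerTailThreePointProductFormOrbits
import Summits.CriticalPhenomena.PercolationContinuityZ3.Theorems.PercNearOneGluingNoHeavyLowerTailThreePointProductFormVisibleSign

/-!
# The orbit of the seed `w₀ = (−39/800, 3/200, 0)` enters the completely-positive cone after one letter; amplitude signs of the
# corrected hub column (Sahi programme, one-child boundary-star cycle, prover prim-sahi-p2 gen 74)

Support file (`--supports stmt-CriticalPhenomena-4575`).  Standard axioms, no sorries, no named facts, no new definitions.  Memo
`run/shared/lean/prim/prim-sahi/FROM-prim-sahi-p2-gen74-HUB-RUNS.md` §8, `prim-sahi-p2/PROOF-E3.md` §84(i).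

By `…ThreePointProductFormOrbits` (`colPhat_eq_orbit`) the corrected hub column of every state is `m̂₊ = (3/5)·m₋ + (8/3)·M_w w₀` with the PURE
orbit `M_w w₀ = iterSD w w₀` of the seed `w₀ = (−39/800, 3/200, 0)` — a `β𝕄`-timelike vector (`β𝕄(w₀,w₀) < 0`, `w₀ ∉ ±L`).  Here:
* `negOrbit_w0_step` — for EVERY letter `(s,d)` (no physicality needed) `−M(s,d)w₀ ∈ L = ι⁻¹(PSD₂)` (the quadratic form of `ι(−M(s,d)w₀)` is the
  explicit sum of squares `(96/1600)(sa)² + (3/400)(da)² + (3/400)(sb)² + (3/6400)(db)² + (9/1600)(2sa + db/2)²`);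
* ★ `negOrbit_w0_inL` — hence, by THEOREM N′ (`inL_mSD`: `L` is invariant under every `M(s,d)`), `−M_w w₀ ∈ L` for every NONEMPTY word `w`:
  the orbit column is a POSITIVE orbit like `−col₁, −col₂` (`cols_negL`), and `β𝕄(M_u w₀, M_w w₀) ≥ 0` for all nonempty `u, w` (`betaM_orbit_w0_nonneg`);
* `readout_nonneg_of_inL` — every readout `x + λy` with `9/4 ≤ λ ≤ 4` is `≥ 0` on `L` (`x + λy = ((4−λ)/7)ι₁₁ + ((4λ−9)/7)ι₂₂`);
* ★ `colPhat_readout_nonpos` — THE AMPLITUDE SIGN OF THE CORRECTED HUB COLUMN: along every physical word and for every `9/4 ≤ λ ≤ 653/216`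
  (an interval containing `λ₊ = (15+√65)/8 = 2.8828`), `(m̂₊).x + λ·(m̂₊).y ≤ 0` — from the orbit law and the visible sign law
  `(m₋).x + λ(m₋).y ≤ 0` (`colM_x_add_mul_y_nonpos`, `λ ∈ [51/40, 653/216]`); at `λ = λ₊` this is `a₊ = L₊(m̂₊) ≤ 0`, the sign of the
  κ-corrected `λ₊`-amplitude of the memo (§0(4)).
[this work] (gen 74).
-/

namespace Summit.CriticalPhenomena.PercolationContinuityZ3.Theorems.ProductFormABPlus

open ProductFormCorners (V3)
open ProductFormModuleCone (mSD iterSD)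
open ProductFormModuleCP (inL qf i11 i12 i22 inL_mSD inL_iff betaM_nonneg_of_inL)

/-- `M(s,d)` commutes with negation. [this work] -/
theorem mSD_neg (s d : ℚ) (v : V3) :
    mSD s d ⟨-v.x, -v.y, -v.z⟩ = ⟨-(mSD s d v).x, -(mSD s d v).y, -(mSD s d v).z⟩ := by
  ext <;> simp [mSD] <;> ring

/-- After ONE letter — any real `(s,d)` — the negated orbit of `w₀` lies in `L`: `ι(−M(s,d)w₀) ⪰ 0`, by the explicit sum of squares
`(96/1600)(sa)² + (3/400)(da)² + (3/400)(sb)² + (3/6400)(db)² + (9/1600)(2sa + db/2)²`. [this work] -/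
theorem negOrbit_w0_step (s d : ℚ) :
    inL ⟨-(mSD s d ⟨-(39/800), 3/200, 0⟩).x, -(mSD s d ⟨-(39/800), 3/200, 0⟩).y, -(mSD s d ⟨-(39/800), 3/200, 0⟩).z⟩ := by
  intro a b
  simp only [qf, i11, i12, i22, mSD]
  nlinarith [sq_nonneg (s * a), sq_nonneg (d * a), sq_nonneg (s * b), sq_nonneg (d * b), sq_nonneg (2 * (s * a) + (d * b) / 2)]

/-- ★ THE ORBIT CONE LAW: for every NONEMPTY word `w` (any real letters), `−M_w w₀ ∈ L`. [this work] -/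
theorem negOrbit_w0_inL (w : List (ℚ × ℚ)) (hne : w ≠ []) :
    inL ⟨-(iterSD w ⟨-(39/800), 3/200, 0⟩).x, -(iterSD w ⟨-(39/800), 3/200, 0⟩).y, -(iterSD w ⟨-(39/800), 3/200, 0⟩).z⟩ := by
  induction w with
  | nil => exact absurd rfl hne
  | cons θ w ih =>
    simp only [iterSD]
    by_cases hw : w = []
    · subst hw
      simp only [iterSD]
      exact negOrbit_w0_step θ.1 θ.2
    · rw [← mSD_neg]
      exact inL_mSD θ.1 θ.2 (ih hw)

/-- `β𝕄` is even: `β𝕄(−a, −b) = β𝕄(a, b)`. [this work] -/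
theorem betaM_neg_neg (a b : V3) : betaM ⟨-a.x, -a.y, -a.z⟩ ⟨-b.x, -b.y, -b.z⟩ = betaM a b := by
  simp only [betaM]; ring

/-- ★ The two `w₀`-orbits of any two NONEMPTY words pair nonnegatively: `β𝕄(M_u w₀, M_w w₀) ≥ 0` (`L` is `β𝕄`-acute). [this work] -/
theorem betaM_orbit_w0_nonneg (u w : List (ℚ × ℚ)) (hu : u ≠ []) (hw : w ≠ []) :
    0 ≤ betaM (iterSD u ⟨-(39/800), 3/200, 0⟩) (iterSD w ⟨-(39/800), 3/200, 0⟩) := by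
  rw [← betaM_neg_neg]
  exact betaM_nonneg_of_inL (negOrbit_w0_inL u hu) (negOrbit_w0_inL w hw)

/-- Readouts `x + λy` with `9/4 ≤ λ ≤ 4` are nonnegative on `L`: `x + λy = ((4−λ)/7)·ι₁₁ + ((4λ−9)/7)·ι₂₂`. [this work] -/
theorem readout_nonneg_of_inL {v : V3} (hv : inL v) (lam : ℚ) (h1 : 9/4 ≤ lam) (h2 : lam ≤ 4) : 0 ≤ v.x + lam * v.y := by
  obtain ⟨h11, h22, _⟩ := (inL_iff v).mp hv
  simp only [i11, i22] at h11 h22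
  nlinarith [mul_nonneg (show (0:ℚ) ≤ 4 - lam by linarith) h11, mul_nonneg (show (0:ℚ) ≤ 4 * lam - 9 by linarith) h22]

/-- The orbit readouts are nonpositive: `(M_w w₀).x + λ(M_w w₀).y ≤ 0` for nonempty `w` and `9/4 ≤ λ ≤ 4`. [this work] -/
theorem orbit_w0_readout_nonpos (w : List (ℚ × ℚ)) (hne : w ≠ []) (lam : ℚ) (h1 : 9/4 ≤ lam) (h2 : lam ≤ 4) :
    (iterSD w ⟨-(39/800), 3/200, 0⟩).x + lam * (iterSD w ⟨-(39/800), 3/200, 0⟩).y ≤ 0 := by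
  have h := readout_nonneg_of_inL (negOrbit_w0_inL w hne) lam h1 h2
  simp only at h
  linarith

/-- ★ THE AMPLITUDE SIGN OF THE CORRECTED HUB COLUMN.  Along every physical word, `(m̂₊).x + λ·(m̂₊).y ≤ 0` for every `9/4 ≤ λ ≤ 653/216`
(at `λ = λ₊`: `a₊ = L₊(m̂₊) ≤ 0`).  Depth `0`: `m̂₊(ω) = (8/3)w₀` and `−39/800 + 3λ/200 ≤ 0` for `λ ≤ 13/4`; depth `≥ 1`:
`m̂₊ = (3/5)m₋ + (8/3)M_w w₀` with both readouts `≤ 0` (`colM_x_add_mul_y_nonpos`, `orbit_w0_readout_nonpos`). [this work] -/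
theorem colPhat_readout_nonpos (w : List (ℚ × ℚ)) (hw : ∀ θ ∈ w, 0 ≤ θ.1 + θ.2 ∧ 0 ≤ θ.1 - θ.2)
    (lam : ℚ) (h1 : 9/4 ≤ lam) (h2 : lam ≤ 653/216) :
    (colPhat (brunA w omegaA)).x + lam * (colPhat (brunA w omegaA)).y ≤ 0 := by
  by_cases hne : w = []
  · subst hne
    simp only [colPhat, colP, brunA, omegaA]
    nlinarith
  · rw [colPhat_eq_orbit]
    simp only
    have hM := colM_x_add_mul_y_nonpos w hw lam (by linarith) h2
    have hO := orbit_w0_readout_nonpos w hne lam h1 (by linarith)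
    nlinarith

end Summit.CriticalPhenomena.PercolationContinuityZ3.Theorems.ProductFormABPlus
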